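import Literature.NumberTheory.EllipticCurves.Kato2004.EulerSystemBoundFineSelmer
import Literature.NumberTheory.EllipticCurves.Kato2004.EulerSystemHypothesisVProofs
import Literature.NumberTheory.EllipticCurves.Kato2004.ZetaLiftEulerSystemClassProofs
import Literature.NumberTheory.EllipticCurves.SerreAdicOpenImageCongruence
import Literature.NumberTheory.EllipticCurves.Kato2004.IwasawaH1ProjZeroKernelProofs
import Literature.NumberTheory.EllipticCurves.Kato2004.DivisibilityInputsZetaLine
import Literature.NumberTheory.EllipticCurves.Kim2025.FineOneSidedDivisibility
import Literature.NumberTheory.EllipticCurves.IwasawaModuleFinitePadicIntProofs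
import Summits.BirchSwinnertonDyer.BirchSwinnertonDyer.Theorems.KatoDescentPotSupersingularReducibleFineSelmerMuZero
import Summits.BirchSwinnertonDyer.BirchSwinnertonDyer.Theorems.SmallImageMuTransferMuTransferStubX9MuBookkeeping
import HarnessLib

/-!
# Kato's Euler-system bound OFF `p` on the fine Selmer group for EVERY non-CM curve (small image allowed),
# from named facts: Kato Thm. 13.4 (2) + Serre's `p`-adic open image; applied to Kato's own zeta class (Z0)

Seat `bsd-potss-rkm` g15 (prover; cell `bsd-potss`), item stmt-BirchSwinnertonDyer-19196 `ReducibleKatoMember` =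
crux M of K9 `KatoDescentPotSupersingular` / K8-t′ `KatoDescentTamePotSupersingular` (`--supports … --as helper`;
closes nothing).  HONEST FRAMING (cell): BSD is not proved by any of this; nothing is booked; crux M stays
cite-level on {modularity, `Kato2004.exists_memberHullZetaInputs`}.

WHAT.  The tree's transcription of Kato's GENERAL Euler-system theorem
(`Kato2004.thm13_4_lengthAt_fineSelmerDual_le_of_isEulerSystemClass`, reduction-free) has three binders beyond
the curve and the tower: a GENUINE Λ-adic Euler-system class `s` (`IsEulerSystemClass`), `s ≠ 0`, and Kato's
hypothesis (v) («some `σ ∈ Gal(ℚ̄/ℚ(ζ_{p^∞}))` with `Coker(ρ(σ) − 1)` of `ℤ_p`-rank `1`»).  So far (v) was only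
available on the BIG-image rows ((12.5.2), `exists_quotient_range_sub_one_equiv_of_imageContainsSL2`), i.e.
exactly NOT on the rows of crux M (`E[p]` reducible) nor on the U₀-ns rows of K9/KT (irreducible, tower not
onto).  This file removes that restriction for every NON-CM curve:
* `exists_hypothesisV_of_not_hasCM` — (v) for `T_pW`, `W` non-CM, any `p`: Serre's `p`-adic open image in
  congruence form (fact `serre_adicImage_contains_congruenceSubgroup`, AEC III.7.9 (a)) + the kernel step
  `exists_finrank_quotient_range_sub_one_eq_one_of_forall_congruence` (transvection `1 + p^n e₀₁`);
* `lengthAt_fineSelmerDual_le_of_isEulerSystemClass_of_not_hasCM` — **Kato Thm. 13.4 (2) on every non-CM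
  row**: for a genuine Euler-system class `s ≠ 0` in `𝐇¹_Γ(T_pW)`, `ℓ_𝔭(X₀(W/ℚ_∞)) ≤ ℓ_𝔭(𝐇¹_Γ/Λs)` at every
  height-one `𝔭 ∌ p`, modulo {Thm. 13.4 fact, Serre fact} — no image hypothesis at `p`;
* `lengthAt_fineSelmerDual_le_of_zetaBody_of_not_hasCM` — the same for KATO'S OWN zeta class: the Λ-adic lift
  `𝐲` of any `ZetaBody` family (Z0 / `forall_exists_zetaBody_of_member` supply one at every curve) is a genuine
  Euler-system class (`isEulerSystemClass_of_zetaBody`, this seat), so `ℓ_𝔭(X₀) ≤ ℓ_𝔭(𝐇¹_Γ/Λ𝐲)` off `p`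
  whenever `𝐲 ≠ 0`.
* `charIdeal_le_charIdeal_fineSelmerDual_of_not_irreducible` — **THE Λ-ADIC DIVISIBILITY ON THE ROWS OF
  CRUX M**: for `W` non-CM with `E[p]` REDUCIBLE (`p` odd), a genuine Euler-system class `s ≠ 0` with
  `𝐇¹_Γ/Λs` torsion, and any fine Selmer dual datum `Y`: `char_Λ(𝐇¹_Γ(T_pW)/Λs) ⊆ char_Λ X₀(W/ℚ_∞)`, i.e.
  **`char X₀ ∣ char(𝐇¹_Γ/Λs)`**, modulo the four named facts {Kato 13.4, Serre, Ferrero–Washington, Lim 3.5}: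
  off `p` by the previous bullet; AT `(p)` because statement (A) holds on reducible rows
  (`ReducibleFineSelmerMuZero.fineSelmerDual_moduleFinite_of_not_irreducible`, this seat) so
  `ℓ_(p)(X₀) = 0` (`exists_fineSelmerDualData_moduleFinite_iff_finite_pTorsion`,
  `KatoMuSkeleton.lengthAt_eq_zero_of_finite_quotient_p`); lengths ⟹ characteristic ideals by
  `Kim2025.charIdeal_le_charIdeal_of_lengthAt_le`.  `…_of_zetaBody_…` = the same for Kato's zeta lift.
This is the Iwasawa-level half of the road «M ⟸ {modularity, Z0, Kato 13.4, Serre, FW + Lim 3.5,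
Poitou–Tate count}» (HOME/rkm/FINDING-19196-rkm-g15.md) from GENERAL printed theorems only — no member
package.  NOT claimed: the level-0 descent (Prop. 14.16 (2) count); M itself stays cite-level.

References: [Kato2004Asterisque] Thm. 13.4 (p. 226), Ex. 13.3 (p. 225), §13.8 (p. 228); [SilvermanAEC2009]
Thm. III.7.9 (a); [Rubin2000] §2.3; tree `Kato2004/{EulerSystemBoundFineSelmer, EulerSystemHypothesisVProofs,
ZetaLiftEulerSystemClassProofs, EulerSystemClasses}.lean`, `SerreAdicOpenImageCongruence.lean`.
-/

-- the summit and its single problem are both named `BirchSwinnertonDyer` (registry layout D-0017)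
set_option linter.dupNamespace false
set_option autoImplicit false

noncomputable section

open scoped NumberField TensorProduct
open Field IsDedekindDomain WeierstrassCurve
open Literature.NumberTheory.GaloisRepresentations Literature.NumberTheory.EllipticCurves
open Literature.NumberTheory.EllipticCurves.Kato2004 Literature.NumberTheory.EllipticCurves.Kato2004.EulerSystemValues

namespace Summit.BirchSwinnertonDyer.BirchSwinnertonDyer.Theorems.SmallImageEulerSystemBoundOffP

/-- **Kato's hypothesis (v) of Thm. 13.4 for `T_pW`, `W` non-CM, ANY prime `p`** (small image allowed),
modulo Serre's `p`-adic open image theorem in congruence form: some `σ ∈ Gal(ℚ̄/ℚ(ζ_{p^∞}))` has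
`Coker(ρ(σ) − 1 : T_pW → T_pW)` of `ℤ_p`-rank `1`.
[cite: Kato2004Asterisque, Thm. 13.4 hypothesis (v) (p. 226)] [cite: SilvermanAEC2009, Thm. III.7.9 (a)] -/
theorem exists_hypothesisV_of_not_hasCM (hSerre : serre_adicImage_contains_congruenceSubgroup)
    (W : WeierstrassCurve ℚ) [W.IsElliptic] (p : ℕ) [Fact p.Prime] (hCM : ¬ W.HasCM) :
    ∃ σ : absoluteGaloisGroup ℚ,
      (∀ (n : ℕ) (t : AlgebraicClosure ℚ), t ^ p ^ n = 1 → σ • t = t) ∧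
        Module.finrank ℤ_[p]
          ((W.tateModule p) ⧸ LinearMap.range (W.galoisRepTate p σ - 1)) = 1 := by
  obtain ⟨n, hn⟩ := hSerre W p hCM
  exact exists_finrank_quotient_range_sub_one_eq_one_of_forall_congruence W p n hn

/-- **Kato Thm. 13.4 (2) on every NON-CM row** (no image hypothesis at `p`), modulo {the Thm. 13.4 fact,
Serre's `p`-adic open image}: for `p` odd, the cyclotomic `κ` with generator `γ`, pinned `I`, `FB`, and a
genuine Λ-adic Euler-system class `s ≠ 0`, `ℓ_𝔭(X₀(W/ℚ_∞)) ≤ ℓ_𝔭(𝐇¹_Γ(T_pW)/Λs)` at every height-one prime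
`𝔭 ∌ p`. [cite: Kato2004Asterisque, Thm. 13.4 (2) (p. 226)] [cite: SilvermanAEC2009, Thm. III.7.9 (a)] -/
theorem lengthAt_fineSelmerDual_le_of_isEulerSystemClass_of_not_hasCM
    (h134 : thm13_4_lengthAt_fineSelmerDual_le_of_isEulerSystemClass)
    (hSerre : serre_adicImage_contains_congruenceSubgroup)
    (W : WeierstrassCurve ℚ) [W.IsElliptic] (p : ℕ) [Fact p.Prime]
    [ContinuousSMul ℤ_[p] (W.tateModule p)] [Module.Free ℤ_[p] (W.tateModule p)]
    [Module.Finite ℤ_[p] (W.tateModule p)]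
    (κ : ZpExtension ℚ p) (γ : absoluteGaloisGroup ℚ) (hp : p ≠ 2) (hκ : κ.IsCyclotomic)
    (hγ : κ.IsTopGenerator γ) (hCM : ¬ W.HasCM)
    (I : IwasawaH1Data W p κ γ) (FB : W.FineSelmerDualData κ γ) (s : I.H)
    (hs : IsEulerSystemClass W p κ γ I s) (hs0 : s ≠ 0)
    (𝔭 : PrimeSpectrum (IwasawaAlgebra p)) (h𝔭 : 𝔭.asIdeal.height = 1)
    (hp𝔭 : PowerSeries.C (p : ℤ_[p]) ∉ 𝔭.asIdeal) :
    Module.lengthAt (IwasawaAlgebra p) FB.X 𝔭 ≤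
      Module.lengthAt (IwasawaAlgebra p) (I.H ⧸ Submodule.span (IwasawaAlgebra p) {s}) 𝔭 :=
  (h134 W p κ γ hp hκ hγ I FB s hs hs0 (exists_hypothesisV_of_not_hasCM hSerre W p hCM)).1 𝔭 h𝔭 hp𝔭

/-- **Kato Thm. 13.4 (2) for KATO'S OWN zeta class on every non-CM row**: for a `ZetaBody` family
(`(c,d,a(A))`-zeta elements with values; `2cdAN ≠ 0`) and its Λ-adic lift `𝐲` (`proj n 𝐲 = Cor z_{n+1,∅}`),
`𝐲` is a genuine Euler-system class (`isEulerSystemClass_of_zetaBody`), so for `𝐲 ≠ 0`: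
`ℓ_𝔭(X₀(W/ℚ_∞)) ≤ ℓ_𝔭(𝐇¹_Γ/Λ𝐲)` at every height-one `𝔭 ∌ p`, modulo {Thm. 13.4 fact, Serre}.
[cite: Kato2004Asterisque, Thm. 13.4 (2) (p. 226), Ex. 13.3 (p. 225)] [cite: SilvermanAEC2009, Thm. III.7.9 (a)] -/
theorem lengthAt_fineSelmerDual_le_of_zetaBody_of_not_hasCM
    (h134 : thm13_4_lengthAt_fineSelmerDual_le_of_isEulerSystemClass)
    (hSerre : serre_adicImage_contains_congruenceSubgroup)
    (W : WeierstrassCurve ℚ) [W.IsElliptic] (p : ℕ) [Fact p.Prime]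
    [ContinuousSMul ℤ_[p] (W.tateModule p)] [Module.Free ℤ_[p] (W.tateModule p)]
    [Module.Finite ℤ_[p] (W.tateModule p)]
    {κ : ZpExtension ℚ p} {γ : absoluteGaloisGroup ℚ} (hp : p ≠ 2) (hκ : κ.IsCyclotomic)
    (hγ : κ.IsTopGenerator γ) (hCM : ¬ W.HasCM)
    (I : IwasawaH1Data W p κ γ) (FB : W.FineSelmerDualData κ γ)
    {N : ℕ} {f : CuspForm (CongruenceSubgroup.Gamma0 N) 2}
    {ι : (m : ℕ) → (CyclotomicField m ℚ →+* ℂ)} {κ' : ℝ}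
    {Λ' : ∀ (k : ℕ) (r : Finset (HeightOneSpectrum (𝓞 ℚ))),
      H1 (tateRep W p) (cycSubgroup p k r) →ₗ[ℤ_[p]] ℚ_[p] ⊗[ℚ] CyclotomicField (cycLevel p k r) ℚ}
    {c d a : ℤ} {A : ℕ}
    {z : ∀ (k : ℕ) (r : (cyclotomicLevelsRat p (badPlaces c d A N)).Ideals),
      H1 (tateRep W p) ((cyclotomicLevelsRat p (badPlaces c d A N)).level k r.1)}
    {x : ∀ (k : ℕ) (r : (cyclotomicLevelsRat p (badPlaces c d A N)).Ideals),
      CyclotomicField (cycLevel p k r.1) ℚ}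
    (hbody : ZetaBody W p f ι κ' Λ' c d a A z x) (hne : 2 * c.natAbs * d.natAbs * A * N ≠ 0)
    {y : I.H} (hy : ∀ n : ℕ, I.proj n y = levelToLayer W p hκ hp (badPlaces c d A N) n
      (z (n + 1) (cyclotomicLevelsRat p (badPlaces c d A N)).idealOne))
    (hy0 : y ≠ 0)
    (𝔭 : PrimeSpectrum (IwasawaAlgebra p)) (h𝔭 : 𝔭.asIdeal.height = 1)
    (hp𝔭 : PowerSeries.C (p : ℤ_[p]) ∉ 𝔭.asIdeal) :
    Module.lengthAt (IwasawaAlgebra p) FB.X 𝔭 ≤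
      Module.lengthAt (IwasawaAlgebra p) (I.H ⧸ Submodule.span (IwasawaAlgebra p) {y}) 𝔭 :=
  lengthAt_fineSelmerDual_le_of_isEulerSystemClass_of_not_hasCM h134 hSerre W p κ γ hp hκ hγ hCM I FB y
    (isEulerSystemClass_of_zetaBody W p hκ hp I hbody hne hy) hy0 𝔭 h𝔭 hp𝔭

/-! ### The Λ-adic divisibility `char X₀ ∣ char(𝐇¹_Γ/Λs)` on the reducible non-CM rows -/

/-- **Kato–Wuthrich divisibility on the rows of crux M (reducible, non-CM), from four named facts.**
For `W/ℚ` elliptic without CM, `p` odd with `E[p]` REDUCIBLE, the cyclotomic `(κ, γ)`, pinned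
`I : IwasawaH1Data` and ANY dual fine Selmer datum `Y`, and a genuine Λ-adic Euler-system class `s ≠ 0`
with `𝐇¹_Γ/Λs` torsion (e.g. rank `𝐇¹_Γ ≤ 1`): `char_Λ(𝐇¹_Γ(T_pW)/Λs) ⊆ char_Λ X₀(W/ℚ_∞)` — Kato's
Thm. 13.4 (2) at the height-one primes `𝔭 ∌ p` (hypothesis (v) by Serre's open image, `W` non-CM) and
`μ(X₀) = 0` at `𝔭 = (p)` (statement (A) on reducible rows: Ferrero–Washington + Lim 2017 Thm. 3.5, the
Borel field being abelian).  Modulo {`thm13_4_…`, `serre_adicImage_…`, `ferreroWashington1979_…`,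
`Lim2017.thm35_…`}; nothing else. [cite: Kato2004Asterisque, Thm. 13.4 (2) (p. 226), Thm. 12.5 (3)–(4) (p. 222)]
[cite: Wuthrich2014, Lemma 14 (p. 396)] [cite: SilvermanAEC2009, Thm. III.7.9 (a)] -/
theorem charIdeal_le_charIdeal_fineSelmerDual_of_not_irreducible
    (h134 : thm13_4_lengthAt_fineSelmerDual_le_of_isEulerSystemClass)
    (hSerre : serre_adicImage_contains_congruenceSubgroup)
    (hLim : Lim2017.thm35_fineSelmerDual_moduleFinite_of_classicalMuVanishes_of_le_divisionField)
    (hFW : Literature.NumberTheory.IwasawaTheory.ferreroWashington1979_classicalMuVanishes)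
    (W : WeierstrassCurve ℚ) [W.IsElliptic] (p : ℕ) [Fact p.Prime]
    [ContinuousSMul ℤ_[p] (W.tateModule p)] [Module.Free ℤ_[p] (W.tateModule p)]
    [Module.Finite ℤ_[p] (W.tateModule p)]
    (κ : ZpExtension ℚ p) (γ : absoluteGaloisGroup ℚ) (hp : p ≠ 2) (hκ : κ.IsCyclotomic)
    (hγ : κ.IsTopGenerator γ) (hCM : ¬ W.HasCM) (hred : ¬ W.HasIrreducibleModPGaloisRep p)
    (I : IwasawaH1Data W p κ γ) (Y : W.FineSelmerDualData κ γ) (s : I.H)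
    (hs : IsEulerSystemClass W p κ γ I s) (hs0 : s ≠ 0)
    (htors : Module.IsTorsion (IwasawaAlgebra p) (I.H ⧸ Submodule.span (IwasawaAlgebra p) {s})) :
    Module.charIdeal (IwasawaAlgebra p) (I.H ⧸ Submodule.span (IwasawaAlgebra p) {s}) ≤
      Module.charIdeal (IwasawaAlgebra p) Y.X := by
  -- statement (A) on the reducible row, then `μ(X₀) = 0` on the pinned datum `Y`
  have hA := ReducibleFineSelmerMuZero.fineSelmerDual_moduleFinite_of_not_irreducible hLim hFW W p hp
    hred κ hκ
  have hfin : Set.Finite {t : W.fineSelmerInfty κ | p • t = 0} :=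
    (IwasawaModuleFinitePadicInt.exists_fineSelmerDualData_moduleFinite_iff_finite_pTorsion W κ hγ).mp hA
  haveI : Module.Finite (IwasawaAlgebra p) Y.X := Y.module_finite_of_finite_pTorsion hγ hfin
  haveI : Finite (Y.X ⧸ (IwasawaAlgebra.augIdealP p • (⊤ : Submodule (IwasawaAlgebra p) Y.X))) :=
    Y.finite_quotient_augIdealP_of_finite_pTorsion hfin
  have hYtors : Module.IsTorsion (IwasawaAlgebra p) Y.X :=
    IwasawaModuleFinitePadicInt.isTorsion_of_finite_quotient_augIdealP p Y.X inferInstance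
  -- `𝐇¹_Γ/Λs` is finitely generated
  haveI : Module.Finite (IwasawaAlgebra p) I.H := IwasawaH1Data.module_finite_of_isCyclotomic hκ hγ I
  -- lengths at every height-one prime
  refine Kim2025.charIdeal_le_charIdeal_of_lengthAt_le htors hYtors fun 𝔭 h𝔭 ↦ ?_
  by_cases hp𝔭 : PowerSeries.C (p : ℤ_[p]) ∈ 𝔭.asIdeal
  · have h0 := Rank1Residual.KatoMuSkeleton.lengthAt_eq_zero_of_finite_quotient_p (M := Y.X) 𝔭
      (eq_augIdealP_of_height_eq_one_of_C_mem 𝔭 h𝔭 hp𝔭)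
    simp [h0]
  · exact lengthAt_fineSelmerDual_le_of_isEulerSystemClass_of_not_hasCM h134 hSerre W p κ γ hp hκ hγ hCM
      I Y s hs hs0 𝔭 h𝔭 hp𝔭

end Summit.BirchSwinnertonDyer.BirchSwinnertonDyer.Theorems.SmallImageEulerSystemBoundOffP

end
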